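/-
Copyright (c) 2026 the pub-hodgecm-mathlib formalisation cell (harness21).  Prover seat hodgecm-mathlib-LH4-p06 (g2): Track A «(D-RAM) FOUR-FRAME» squad of crux H413
(dealer LH4-plan (g10) WORD #45 (2) ∕ #49: U2H ED. 7 hunk pen = LH4-p06 lineage; child (ρ3a) «the anchor's unit FL on the Levi stratum, any Haar measures»), 2026-09-03.
-/
import Summits.HodgeConjecture.HodgeConjecture.Theorems.F0P3cDyRamAnchorCountDictionaryZero      -- ★ (LH4-p01): `isCompact_and_isOpen_of_forall_mem_iff_mapGL_eq` + the self-dual-vertex ∕ `K_std` ∕ one-place-model imports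
import Summits.HodgeConjecture.HodgeConjecture.Theorems.F0P3cDyRamFourFrameHFamilyDefs          -- DEFS LEAF №5: `hFamily = ![hProfileZero, hProfileSharp]`
import Literature.NumberTheory.Rogawski1990.UnitFundamentalLemmaLeviOfFormCongr                   -- ★ p855385 (LH4-p05): `stableOrbitalIntegralRel_indicator_eq_finsum_delta_of_levi_antidiagOne`
import Literature.NumberTheory.Rogawski1990.FinExplicitTransferFactorLeviStratumGerm              -- ★ p855542 (LH4-p07): the Δ‴-Levi germ + `exists_nhds_one_forall_levi_valued_sub_one_le`
import Literature.NumberTheory.Rogawski1990.UnitFundamentalLemmaInertLeviClause                  -- ★ `mem_prod_cmLocalIntegralLevel_of_levi_of_integral_charpoly`, `isLocalGRegular_conj_iff`, `charpoly_map_endoEmbLocal_conj`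
import Literature.NumberTheory.Rogawski1990.UnitStableOrbitalIntegralHSideLevelValueOfIsRoot     -- ★ `OrbitalMeasureFamily.IsCanonical.exists_normalised`, `isCompact_and_interior_nonempty_prod_cmLocalIntegralLevel`
import Literature.NumberTheory.Automorphic.UnitOrbitalIntegralSplitTorusHSide                      -- ★ C′₂ (B-p12): `classOrbitalIntegral_indicator_prod_eq_inv_sqrt_of_torus_regular_of_nonsplit`
import Literature.NumberTheory.Rogawski1990.UnitaryVertexStabilizerSpanCM                         -- ★ `classOrbitalIntegral_comp_conj`
import Literature.NumberTheory.Rogawski1990.LocalTransferLinear                                    -- ★ `isRegularElt_of_isLocalNormPair`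
import Literature.NumberTheory.Rogawski1990.LocalCentralizerTorusMeasureCM                         -- ★ `isRegularElt_fst_snd_of_isLocalGRegular`
import Literature.NumberTheory.Rogawski1990.GRegularLocalisation                                   -- ★ `isLocalGRegular_out_mk`
import HarnessLib

/-!
# F0 · P3c · line LH4 «(D-RAM) FOUR-FRAME» — unit (ii-H), child (ρ3a) of the rows socket (ρ): THE ANCHOR'S UNIT FUNDAMENTAL LEMMA ON THE LEVI STRATUM AT A WILD PLACE,
# FOR ARBITRARY HAAR MEASURES AND AN ARBITRARY SELF-DUAL VERTEX
(Rogawski 1990 §4.9 Prop. 4.9.1 (b), Lemma 4.9.2; §4.3 (4.3.1); Kottwitz 1986 §7)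

Cell `pub/hodgecm-mathlib`, crux H413 = `stmt-HodgeConjecture-24833` (helper lane `--supports stmt-HodgeConjecture-24833`), route HCCMUnconditional; THEOREMS ONLY
(no definition, no instance, no notation, no named fact, no `sorry`).  Tree socket served: ROW (3) of (ρ) `F0P3cDyRamFourFrameU2H.stub_U2H_rowsR_hFamily_unit0`
(`Cruxes/H413/Lines/F0_P3c_DyRamFourFrame_U2H_HSide.lean` ED. 6 :104, :159–:163).

THE MATHEMATICS.  ROW (3) of (ρ) reads, near `1 ∈ H_v` on the Levi population (`γ_H` `G`-regular and `H_v`-conjugate to a diagonal `(diag(d′₀, d′₁), u)`):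
`Σᶠ_c Δ‴_v(γ_H, out c) · Φ(c, 1_{K_t}; mG₃) = Σ_s coef_s · Φ^st(γ_H, hFamily s; mH)` with `K_t` the stabiliser of a self-dual vertex `N` and ARBITRARY Haar measures
`νH`, `νG₃` (canonical families `mH`, `mG₃`).  Its `s = 0` skeleton is the unit fundamental lemma on the Levi stratum: at ANY non-split place (here a wild one)
**`Σᶠ_c Δ‴_v(γ_H, out c) · Φ(c, 1_{K_t}; mG₃) = (νG₃(K_t) ∕ νH(K_H)) · Φ^st(γ_H, 1_{K_H}; mH)`** for all `G`-regular Levi `γ_H` in a neighbourhood of `1`.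
Assembly of ★ inputs only: (i) near `1` every conjugate-diagonal representative `yγ_Hy⁻¹` has `ϖ`-deep eigenvalues (★ p855542 §1), hence lies in `K_H` (★
`mem_prod_cmLocalIntegralLevel_of_levi_of_integral_charpoly`); (ii) ★ p855542 §3 gives `Δ‴_v(yγ_Hy⁻¹, γ₀) = ‖d′₀⁻¹u − 1‖` at every match; (iii) after normalising
both Haar measures on `K_H` ∕ `K₀ = U(Φ₃)(𝒪_v)` (★ `IsCanonical.exists_normalised`: the measures enter through `νH(K_H)`, `νG₃(K₀)` only) ★ C′₂ gives the `H`-side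
value and ★ p855385 the clause at `yγ_Hy⁻¹`, carried back to `γ_H` by ★ `stableOrbitalIntegralRel_eq_finsum_finExplicitDelta_iff_of_isLocalStablyConjH`;
(iv) `K_t = g₀·K₀·g₀⁻¹` (htr₀-WILD, ★ `exists_unitary_mapGL_eq_of_isSelfDualLattice_ramifiedCM`), so `Φ(c, 1_{K_t}) = Φ(c, 1_{K₀})` at every regular class (★
`classOrbitalIntegral_comp_conj`; the non-matching classes carry `Δ‴ = 0`) and `νG₃(K_t) = νG₃(K₀)`.

* §1 `measure_eq_of_forall_mem_iff_conj_mem`, `indicator_eq_comp_conj_of_forall_mem_iff_conj_mem` (generic), `exists_forall_mem_iff_conj_mem_cmLocalIntegralLevel`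
  (`K_t = g₀ K₀ g₀⁻¹`), `finsum_delta_mul_classOrbitalIntegral_indicator_eq_of_forall_mem_iff_conj_mem` (`1_{K_t} ↦ 1_{K₀}` inside the endoscopic sum).
* §2 `exists_nhds_one_forall_levi_mem_prod_cmLocalIntegralLevel` (near `1`, conjugate-diagonal representatives lie in `K_H`).
* §3 HEAD **`exists_nhds_one_finsum_delta_indicator_eq_mul_stableOrbitalIntegralRel_hFamily_zero_of_levi`** (at `K_t`, any Haar measures, `H`-side profile `hFamily … 0`).

HONEST LABEL: HC_CM is proved only modulo the 7 printed citations (2 remaining named inputs: hLiu418 = stmt-HodgeConjecture-24832, h413 = stmt-HodgeConjecture-24833) until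
rung 0 closes; this file is unconditional and count-neutral (a helper toward ROW (3) of (ρ); it freezes no stub text).

## References
* [Rogawski1990] J. D. Rogawski, *Automorphic Representations of Unitary Groups in Three Variables*, Ann. of Math. Stud. 123 (1990): §4.9 Prop. 4.9.1 (b) p. 55,
  Lemma 4.9.2 p. 56; §4.3 (4.3.1) p. 43; §4.1 (4.1.1) p. 40.
* [Kottwitz1986] R. E. Kottwitz, *Base change for unit elements of Hecke algebras*, Compositio Math. 60 (1986): §7.
* [BruhatTits1972] F. Bruhat, J. Tits, *Groupes réductifs sur un corps local I*, Publ. Math. IHÉS 41 (1972), §10 (one orbit of special vertices).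
-/

set_option autoImplicit false

noncomputable section

open scoped Valued WithZero Matrix MatrixGroups NNReal Topology
open MeasureTheory Measure NumberField IsDedekindDomain Matrix Filter
open Literature.NumberTheory.Automorphic Literature.NumberTheory.Automorphic.UnitaryGroup Literature.NumberTheory.Automorphic.HermitianLattice
open Literature.NumberTheory.Automorphic.UnitaryLatticeTree Literature.NumberTheory.Rogawski1990 Literature.NumberTheory.GaloisRepresentations
open Summit.HodgeConjecture.HodgeConjecture.Cruxes.H413.F0P3cDyRamFourFrameHFamilyDefs

namespace Summit.HodgeConjecture.HodgeConjecture.Cruxes.H413.F0P3cDyRamAnchorLeviClause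


/-! ## §1 The stabiliser `K_t` of a self-dual vertex is a conjugate of `K₀ = U(Φ₃)(𝒪_v)`; consequences for Haar masses and unit orbital integrals -/

section Generic

/-- If `y ∈ A ↔ g⁻¹yg ∈ B` then `A` and `B` have the same measure for a two-sided invariant measure. [cite: Rogawski1990, §4.3 (4.3.1) p. 43] -/
theorem measure_eq_of_forall_mem_iff_conj_mem {G : Type*} [Group G] [MeasurableSpace G] [MeasurableMul G]
    (ν : Measure G) [ν.IsMulLeftInvariant] [ν.IsMulRightInvariant]
    {A B : Set G} (g : G) (h : ∀ y, y ∈ A ↔ g⁻¹ * y * g ∈ B) : ν A = ν B := by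
  have hA : A = (fun y => g⁻¹ * y) ⁻¹' ((fun y => y * g) ⁻¹' B) := by
    ext y; exact h y
  rw [hA, measure_preimage_mul, measure_preimage_mul_right]

/-- If `y ∈ A ↔ g⁻¹yg ∈ B` then `1_A = 1_B ∘ Ad(g⁻¹)` (valued in any type with `0`). [cite: Rogawski1990, §4.9 p. 54] -/
theorem indicator_eq_comp_conj_of_forall_mem_iff_conj_mem {G : Type*} [Group G] {M : Type*} [Zero M] {A B : Set G} (g : G)
    (h : ∀ y, y ∈ A ↔ g⁻¹ * y * g ∈ B) (f : M) :
    A.indicator (fun _ => f) = fun x => B.indicator (fun _ => f) (g⁻¹ * x * g⁻¹⁻¹) := by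
  classical
  funext x
  rw [inv_inv]
  by_cases hx : x ∈ A
  · rw [Set.indicator_of_mem hx, Set.indicator_of_mem ((h x).1 hx)]
  · rw [Set.indicator_of_notMem hx, Set.indicator_of_notMem (fun h' => hx ((h x).2 h'))]

end Generic

section CM

variable (L : Type) [Field L] [NumberField L] [IsCMField L] {v : HeightOneSpectrum (𝓞 ↥(maximalRealSubfield L))}
  (w : PlacesOver L v) (hw : IsCMField.complexConj L • w.1 = w.1)

include hw in
/-- **`K_t = g₀·K₀·g₀⁻¹`**: at a ramified non-split place the stabiliser `K_t = {u | e(u)·N = N}` of a self-dual vertex `N` is a conjugate of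
`K₀ = U(Φ₃)(𝒪_v)` (htr₀-WILD at the CM place: `N = e(g₀)·𝒪_w³`, ★ `exists_unitary_mapGL_eq_of_isSelfDualLattice_ramifiedCM`; ★ `mem_cmLocalIntegralLevel_iff_mapGL_stdLattice_eq`).
The proof is the membership half of ★ `isCompact_and_isOpen_of_forall_mem_iff_mapGL_eq`, exported. [cite: BruhatTits1972, §10] [cite: Rogawski1990, §4.9 p. 54] -/
theorem exists_forall_mem_iff_conj_mem_cmLocalIntegralLevel (he : v.asIdeal.ramificationIdx' w.1.asIdeal ≠ 1)
    {ϖ : w.1.adicCompletion L} (hϖ : Valued.v ϖ = WithZero.exp (-1 : ℤ))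
    {N : Submodule 𝒪[w.1.adicCompletion L] (Fin 3 → w.1.adicCompletion L)}
    (hN : IsVertexLattice (galAdicCompletionMap (L := L) (IsCMField.complexConj L) hw) ϖ ((StdForm.antidiagonal 3).over (w.1.adicCompletion L)) 0 N)
    (Kt : Subgroup ((cmDatum L 3 (Matrix.of fun i j : Fin 3 => if i.val + j.val + 1 = 3 then (1 : L) else 0)).Local v))
    (hKt : ∀ u : ((cmDatum L 3 (Matrix.of fun i j : Fin 3 => if i.val + j.val + 1 = 3 then (1 : L) else 0)).Local v), u ∈ Kt ↔
      mapGL ((localNonsplitEquiv (IsCMField.complexConj L) (Matrix.of fun i j : Fin 3 => if i.val + j.val + 1 = 3 then (1 : L) else 0) (IsCMField.complexConj_ne_one L) w hw u :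
        ↥(unitaryGroupOfForm (galAdicCompletionMap (L := L) (IsCMField.complexConj L) hw) (placeForm (Matrix.of fun i j : Fin 3 => if i.val + j.val + 1 = 3 then (1 : L) else 0) w.1))) :
        GL (Fin 3) (w.1.adicCompletion L)) N = N) :
    ∃ g₀ : ((cmDatum L 3 (Matrix.of fun i j : Fin 3 => if i.val + j.val + 1 = 3 then (1 : L) else 0)).Local v),
      ∀ y, y ∈ Kt ↔ g₀⁻¹ * y * g₀ ∈ cmLocalIntegralLevel L 3 (Matrix.of fun i j : Fin 3 => if i.val + j.val + 1 = 3 then (1 : L) else 0) v := by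
  obtain ⟨e, hecoe⟩ := exists_continuousMulEquiv_coe_eq_localNonsplitEquiv L (Matrix.of fun i j : Fin 3 => if i.val + j.val + 1 = 3 then (1 : L) else 0) v w hw
  have hKt' : ∀ y, y ∈ Kt ↔ mapGL ((e y : ↥(unitaryGroupOfForm (galAdicCompletionMap (L := L) (IsCMField.complexConj L) hw)
      (placeForm (Matrix.of fun i j : Fin 3 => if i.val + j.val + 1 = 3 then (1 : L) else 0) w.1))) : GL (Fin 3) (w.1.adicCompletion L)) N = N := fun y => by
    rw [hecoe]; exact hKt y
  have hpf := placeForm_antidiagThree_eq_over L w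
  -- the root `𝒪_w³` is self-dual, hence `N = e(g₀)·𝒪_w³`
  have hϖ1 : Valued.v ϖ ≤ 1 := by rw [hϖ, ← WithZero.exp_zero]; exact WithZero.exp_le_exp.2 (by norm_num)
  have hJ : ∀ i j : Fin 3, (StdForm.antidiagonal 3).over (w.1.adicCompletion L) i j = if j = Fin.rev i then (1 : w.1.adicCompletion L) else 0 := by
    intro i j
    simp only [StdForm.over, Matrix.map_apply, StdForm.antidiagonal_J_apply]
    split_ifs <;> simp
  have hstd : IsSelfDualLattice (galAdicCompletionMap (L := L) (IsCMField.complexConj L) hw) ϖ ((StdForm.antidiagonal 3).over (w.1.adicCompletion L))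
      (stdLattice (w.1.adicCompletion L) 3) := by
    refine isSelfDualLattice_stdLattice (fun i j => ?_) (fun i j => ?_) ?_ hϖ1
    · rw [hJ]; split_ifs <;> simp
    · rw [StdForm.inv_over, hJ]; split_ifs <;> simp
    · rw [det_antidiagonal_three, Valuation.map_neg, map_one]
  obtain ⟨u₀, hu₀⟩ := exists_unitary_mapGL_eq_of_isSelfDualLattice_ramifiedCM L v w hw he hϖ hstd hN
  have hu₀' : (u₀ : GL (Fin 3) (w.1.adicCompletion L)) ∈ unitaryGroupOfForm (galAdicCompletionMap (L := L) (IsCMField.complexConj L) hw)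
      (placeForm (Matrix.of fun i j : Fin 3 => if i.val + j.val + 1 = 3 then (1 : L) else 0) w.1) := by
    rw [hpf]; exact u₀.2
  set g₀ : (cmDatum L 3 (Matrix.of fun i j : Fin 3 => if i.val + j.val + 1 = 3 then (1 : L) else 0)).Local v :=
    e.symm ⟨(u₀ : GL (Fin 3) (w.1.adicCompletion L)), hu₀'⟩ with hg₀
  have heg₀ : ((e g₀ : ↥(unitaryGroupOfForm (galAdicCompletionMap (L := L) (IsCMField.complexConj L) hw)
      (placeForm (Matrix.of fun i j : Fin 3 => if i.val + j.val + 1 = 3 then (1 : L) else 0) w.1))) : GL (Fin 3) (w.1.adicCompletion L)) =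
      (u₀ : GL (Fin 3) (w.1.adicCompletion L)) := by
    rw [hg₀, ContinuousMulEquiv.apply_symm_apply]
  have key : ∀ y, mapGL ((e y : ↥(unitaryGroupOfForm (galAdicCompletionMap (L := L) (IsCMField.complexConj L) hw)
      (placeForm (Matrix.of fun i j : Fin 3 => if i.val + j.val + 1 = 3 then (1 : L) else 0) w.1))) : GL (Fin 3) (w.1.adicCompletion L)) N = N ↔
      mapGL ((u₀ : GL (Fin 3) (w.1.adicCompletion L))⁻¹ * ((e y : ↥(unitaryGroupOfForm (galAdicCompletionMap (L := L) (IsCMField.complexConj L) hw)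
        (placeForm (Matrix.of fun i j : Fin 3 => if i.val + j.val + 1 = 3 then (1 : L) else 0) w.1))) : GL (Fin 3) (w.1.adicCompletion L)) *
        (u₀ : GL (Fin 3) (w.1.adicCompletion L))) (stdLattice (w.1.adicCompletion L) 3) = stdLattice (w.1.adicCompletion L) 3 := by
    intro y
    rw [mapGL_mul, mapGL_mul, hu₀]
    constructor
    · intro h; rw [h, ← hu₀, mapGL_inv_mapGL]
    · intro h
      have h' := congrArg (mapGL (u₀ : GL (Fin 3) (w.1.adicCompletion L))) h
      rw [← mapGL_mul, mul_inv_cancel, mapGL_one, hu₀] at h'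
      exact h'
  refine ⟨g₀, fun y => ?_⟩
  rw [hKt' y, key y, mem_cmLocalIntegralLevel_iff_mapGL_stdLattice_eq L (Matrix.of fun i j : Fin 3 => if i.val + j.val + 1 = 3 then (1 : L) else 0) v w hw, ← hecoe,
    map_mul, map_mul, map_inv, Subgroup.coe_mul, Subgroup.coe_mul, Subgroup.coe_inv, heg₀]

open scoped Classical in
/-- **`Σᶠ_c Δ(γ_H, out c)·Φ(c, 1_{K_t}) = Σᶠ_c Δ(γ_H, out c)·Φ(c, 1_{K₀})`** for `K_t = g₀K₀g₀⁻¹`, `γ_H` `G`-regular, ANY local transfer factor `T` and any family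
admissible at the regular classes: the matching classes are regular (★ `isRegularElt_of_isLocalNormPair`) and there `Φ(c, 1_{K₀} ∘ Ad g₀⁻¹) = Φ(c, 1_{K₀})`
(★ `classOrbitalIntegral_comp_conj`); elsewhere `Δ = 0`. [cite: Rogawski1990, §4.3 (4.3.1) p. 43; §4.9 p. 54] -/
theorem finsum_delta_mul_classOrbitalIntegral_indicator_eq_of_forall_mem_iff_conj_mem
    [∀ γ : ((cmDatum L 3 (Matrix.of fun i j : Fin 3 => if i.val + j.val + 1 = 3 then (1 : L) else 0)).Local v),
      MeasurableSpace (((cmDatum L 3 (Matrix.of fun i j : Fin 3 => if i.val + j.val + 1 = 3 then (1 : L) else 0)).Local v) ⧸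
        Subgroup.centralizer ({γ} : Set ((cmDatum L 3 (Matrix.of fun i j : Fin 3 => if i.val + j.val + 1 = 3 then (1 : L) else 0)).Local v)))]
    [∀ γ : ((cmDatum L 3 (Matrix.of fun i j : Fin 3 => if i.val + j.val + 1 = 3 then (1 : L) else 0)).Local v),
      BorelSpace (((cmDatum L 3 (Matrix.of fun i j : Fin 3 => if i.val + j.val + 1 = 3 then (1 : L) else 0)).Local v) ⧸
        Subgroup.centralizer ({γ} : Set ((cmDatum L 3 (Matrix.of fun i j : Fin 3 => if i.val + j.val + 1 = 3 then (1 : L) else 0)).Local v)))]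
    (T : LocalTransferFactor L (Matrix.of fun i j : Fin 3 => if i.val + j.val + 1 = 3 then (1 : L) else 0) v)
    {mG₃ : OrbitalMeasureFamily ((cmDatum L 3 (Matrix.of fun i j : Fin 3 => if i.val + j.val + 1 = 3 then (1 : L) else 0)).Local v)}
    (hmG : mG₃.IsAdmissibleOn (fun γ => IsRegularElt (γ.val : GL (Fin 3) (UnitaryGroup.LocalRing L v))))
    (Kt : Subgroup ((cmDatum L 3 (Matrix.of fun i j : Fin 3 => if i.val + j.val + 1 = 3 then (1 : L) else 0)).Local v))
    (g₀ : ((cmDatum L 3 (Matrix.of fun i j : Fin 3 => if i.val + j.val + 1 = 3 then (1 : L) else 0)).Local v))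
    (hg₀ : ∀ y, y ∈ Kt ↔ g₀⁻¹ * y * g₀ ∈ cmLocalIntegralLevel L 3 (Matrix.of fun i j : Fin 3 => if i.val + j.val + 1 = 3 then (1 : L) else 0) v)
    {γH : ((cmDatum L 2 (Matrix.of fun i j : Fin 2 => if i.val + j.val + 1 = 2 then (1 : L) else 0)).Local v ×
      (cmDatum L 1 (Matrix.of fun i j : Fin 1 => if i.val + j.val + 1 = 1 then (1 : L) else 0)).Local v)} (hreg : IsLocalGRegular L v γH) :
    ∑ᶠ c : ConjClasses ((cmDatum L 3 (Matrix.of fun i j : Fin 3 => if i.val + j.val + 1 = 3 then (1 : L) else 0)).Local v),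
        T.Δ γH (Quotient.out c) *
          classOrbitalIntegral mG₃ (Set.indicator (Kt : Set ((cmDatum L 3 (Matrix.of fun i j : Fin 3 => if i.val + j.val + 1 = 3 then (1 : L) else 0)).Local v)) (fun _ => (1 : ℂ))) c =
      ∑ᶠ c : ConjClasses ((cmDatum L 3 (Matrix.of fun i j : Fin 3 => if i.val + j.val + 1 = 3 then (1 : L) else 0)).Local v),
        T.Δ γH (Quotient.out c) *
          classOrbitalIntegral mG₃ ((cmLocalIntegralLevel L 3 (Matrix.of fun i j : Fin 3 => if i.val + j.val + 1 = 3 then (1 : L) else 0) v :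
            Set ((cmDatum L 3 (Matrix.of fun i j : Fin 3 => if i.val + j.val + 1 = 3 then (1 : L) else 0)).Local v)).indicator fun _ => (1 : ℂ)) c := by
  refine finsum_congr fun c => ?_
  by_cases hc : IsLocalNormPair L (Matrix.of fun i j : Fin 3 => if i.val + j.val + 1 = 3 then (1 : L) else 0) v γH (Quotient.out c)
  · have hcreg : IsRegularElt ((Quotient.out c).val : GL (Fin 3) (UnitaryGroup.LocalRing L v)) :=
      isRegularElt_of_isLocalNormPair L (Matrix.of fun i j : Fin 3 => if i.val + j.val + 1 = 3 then (1 : L) else 0) v hc hreg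
    rw [indicator_eq_comp_conj_of_forall_mem_iff_conj_mem g₀ hg₀ (1 : ℂ),
      classOrbitalIntegral_comp_conj L (Matrix.of fun i j : Fin 3 => if i.val + j.val + 1 = 3 then (1 : L) else 0) v hmG c hcreg _ g₀⁻¹]
  · rw [T.eq_zero_of_not_rel _ _ hc, zero_mul, zero_mul]

end CM

/-! ## §2 Near `1`, conjugate-diagonal representatives lie in `K_H` -/

section KH

variable (L : Type) [Field L] [NumberField L] [IsCMField L] (v : HeightOneSpectrum (𝓞 ↥(maximalRealSubfield L)))
  (w : PlacesOver L v) (hw : IsCMField.complexConj L • w.1 = w.1)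

include hw in
/-- **NEAR `1`, LEVI REPRESENTATIVES ARE INTEGRAL**: there is `V ∈ 𝓝 (1 : H_v)` such that for every `γ_H ∈ V` and every conjugate-diagonal witness `y, d′`
(`(yγ_Hy⁻¹).1 = diag(d′₀, d′₁)`), `yγ_Hy⁻¹ ∈ K_H = U(Φ₂)(𝒪_v) × U(Φ₁)(𝒪_v)`: the eigenvalues `d′₀, u, d′₁` of `ι_v(yγ_Hy⁻¹)` are `ϖ`-deep (★ p855542 §1
`exists_nhds_one_forall_levi_valued_sub_one_le`), so `χ_{ι_v(yγ_Hy⁻¹), w} = ∏ (X − d_k,w)` is `𝒪_w`-integral and ★ `mem_prod_cmLocalIntegralLevel_of_levi_of_integral_charpoly`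
applies. [cite: Rogawski1990, §3.1 p. 19; §4.9 p. 55] [cite: BernsteinZelevinsky1976, §1.1] -/
theorem exists_nhds_one_forall_levi_mem_prod_cmLocalIntegralLevel {ϖ : w.1.adicCompletion L} (hϖ : Valued.v ϖ = WithZero.exp (-1 : ℤ)) :
    ∃ V ∈ 𝓝 (1 : (cmDatum L 2 (Matrix.of fun i j : Fin 2 => if i.val + j.val + 1 = 2 then (1 : L) else 0)).Local v ×
        (cmDatum L 1 (Matrix.of fun i j : Fin 1 => if i.val + j.val + 1 = 1 then (1 : L) else 0)).Local v),
      ∀ γH ∈ V, ∀ (y : (cmDatum L 2 (Matrix.of fun i j : Fin 2 => if i.val + j.val + 1 = 2 then (1 : L) else 0)).Local v ×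
          (cmDatum L 1 (Matrix.of fun i j : Fin 1 => if i.val + j.val + 1 = 1 then (1 : L) else 0)).Local v) (d' : Fin 2 → (UnitaryGroup.LocalRing L v)ˣ),
        glDiagonal 2 (UnitaryGroup.LocalRing L v) d' = ((y * γH * y⁻¹).1.val : GL (Fin 2) (UnitaryGroup.LocalRing L v)) →
        y * γH * y⁻¹ ∈ ((cmLocalIntegralLevel L 2 (Matrix.of fun i j : Fin 2 => if i.val + j.val + 1 = 2 then (1 : L) else 0) v).prod
          (cmLocalIntegralLevel L 1 (Matrix.of fun i j : Fin 1 => if i.val + j.val + 1 = 1 then (1 : L) else 0) v)) := by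
  have hϖ0 : ϖ ≠ 0 := by
    intro h; rw [h, map_zero] at hϖ; exact WithZero.zero_ne_coe hϖ
  obtain ⟨V, hV, hdeep⟩ := exists_nhds_one_forall_levi_valued_sub_one_le L v w hϖ0
  refine ⟨V, hV, fun γH hγ y d' hyd' => ?_⟩
  have hι := endoEmbLocal_eq_glDiagonal_of_fst_eq L v (y * γH * y⁻¹) hyd'
  have hdk := hdeep γH hγ y _ hι
  have hlt : Valued.v ϖ < 1 := by rw [hϖ, ← WithZero.exp_zero]; exact WithZero.exp_lt_exp.2 (by norm_num)
  -- every eigenvalue is `w`-integral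
  have hint : ∀ k : Fin 3, ((![d' 0, (isUnit_finGammaTwo L v (y * γH * y⁻¹)).unit, d' 1] k : (UnitaryGroup.LocalRing L v)ˣ) :
      UnitaryGroup.LocalRing L v) w ∈ Valued.integer (w.1.adicCompletion L) := by
    intro k
    rw [Valued.integer, Valuation.mem_integer_iff]
    have hk := (hdk k).trans_lt hlt
    have : Valued.v ((((![d' 0, (isUnit_finGammaTwo L v (y * γH * y⁻¹)).unit, d' 1] k : (UnitaryGroup.LocalRing L v)ˣ) :
        UnitaryGroup.LocalRing L v) w)) = Valued.v ((((![d' 0, (isUnit_finGammaTwo L v (y * γH * y⁻¹)).unit, d' 1] k :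
        (UnitaryGroup.LocalRing L v)ˣ) : UnitaryGroup.LocalRing L v) w - 1) + 1) := by rw [sub_add_cancel]
    rw [this]
    exact le_trans (Valued.v.map_add _ _) (max_le hk.le (by rw [Valued.v.map_one]))
  refine mem_prod_cmLocalIntegralLevel_of_levi_of_integral_charpoly L w hw hyd' fun i => ?_
  have hpoly : ((((endoEmbLocal L v (y * γH * y⁻¹)).val : GL (Fin 3) (UnitaryGroup.LocalRing L v)).val.map
      (Pi.evalRingHom (fun w' : PlacesOver L v => w'.1.adicCompletion L) w)).charpoly) =
      (∏ k : Fin 3, (Polynomial.X - Polynomial.C (⟨_, hint k⟩ : ↥(Valued.integer (w.1.adicCompletion L))))).map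
        (Valued.integer (w.1.adicCompletion L)).subtype := by
    rw [hι, coe_glDiagonal, Matrix.diagonal_map (map_zero _), Matrix.charpoly_diagonal, Polynomial.map_prod]
    refine Finset.prod_congr rfl fun k _ => ?_
    rw [Polynomial.map_sub, Polynomial.map_X, Polynomial.map_C]
    rfl
  rw [hpoly, Polynomial.coeff_map]
  exact Subtype.coe_prop _

end KH

/-! ## §3 HEAD -/

section Head

variable (L : Type) [Field L] [NumberField L] [IsCMField L] {v : HeightOneSpectrum (𝓞 ↥(maximalRealSubfield L))}
  (w : PlacesOver L v) (hw : IsCMField.complexConj L • w.1 = w.1)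

include hw in
open scoped Classical in
/-- **ROW (3)'s `s = 0` SKELETON AT THE (ρ) BINDERS — THE ANCHOR'S UNIT FL ON THE LEVI STRATUM, ANY HAAR MEASURES, ANY SELF-DUAL VERTEX.**  At a ramified non-split place
`w ∣ v`, for canonical families `mH` (at `IsLocalGRegular`, Haar `νH`) and `mG₃` (at `IsRegularElt`, Haar `νG₃`), a self-dual vertex `N` with stabiliser `K_t` (`hKt`), and
`μ` with `μ|_{𝕀_{L⁺}} = ω`: there is `V ∈ 𝓝 (1 : H_v)` such that for every `G`-regular `γ_H ∈ V` which is `H_v`-conjugate to a diagonal,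
`Σᶠ_c Δ‴_v(γ_H, out c)·Φ(c, 1_{K_t}; mG₃) = (νG₃(K_t) ∕ νH(K_H)) · Φ^st(γ_H, hFamily … 0; mH)` (`hFamily … 0 = 1_{K_H}`).
[cite: Rogawski1990, §4.9 Prop. 4.9.1 (b) p. 55; Lemma 4.9.2 p. 56; §4.3 (4.3.1) p. 43; §4.1 (4.1.1) p. 40] [cite: Kottwitz1986, §7] [cite: BruhatTits1972, §10] -/
theorem exists_nhds_one_finsum_delta_indicator_eq_mul_stableOrbitalIntegralRel_hFamily_zero_of_levi
    (he : v.asIdeal.ramificationIdx' w.1.asIdeal ≠ 1)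
    (ϖ : w.1.adicCompletion L) (hϖ : Valued.v ϖ = WithZero.exp (-1 : ℤ))
    (μ : HeckeCharacter L)
    (hμω : ∀ x : ideleGroup ↥(maximalRealSubfield L), μ (AdeleRing.ideleBaseChange ↥(maximalRealSubfield L) L x) = quadraticHeckeCharCM L x)
    [MeasurableSpace ((cmDatum L 3 (Matrix.of fun i j : Fin 3 => if i.val + j.val + 1 = 3 then (1 : L) else 0)).Local v)]
    [BorelSpace ((cmDatum L 3 (Matrix.of fun i j : Fin 3 => if i.val + j.val + 1 = 3 then (1 : L) else 0)).Local v)]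
    [∀ γ : ((cmDatum L 3 (Matrix.of fun i j : Fin 3 => if i.val + j.val + 1 = 3 then (1 : L) else 0)).Local v),
      MeasurableSpace (((cmDatum L 3 (Matrix.of fun i j : Fin 3 => if i.val + j.val + 1 = 3 then (1 : L) else 0)).Local v) ⧸
        Subgroup.centralizer ({γ} : Set ((cmDatum L 3 (Matrix.of fun i j : Fin 3 => if i.val + j.val + 1 = 3 then (1 : L) else 0)).Local v)))]
    [∀ γ : ((cmDatum L 3 (Matrix.of fun i j : Fin 3 => if i.val + j.val + 1 = 3 then (1 : L) else 0)).Local v),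
      BorelSpace (((cmDatum L 3 (Matrix.of fun i j : Fin 3 => if i.val + j.val + 1 = 3 then (1 : L) else 0)).Local v) ⧸
        Subgroup.centralizer ({γ} : Set ((cmDatum L 3 (Matrix.of fun i j : Fin 3 => if i.val + j.val + 1 = 3 then (1 : L) else 0)).Local v)))]
    [MeasurableSpace ((cmDatum L 2 (Matrix.of fun i j : Fin 2 => if i.val + j.val + 1 = 2 then (1 : L) else 0)).Local v ×
      (cmDatum L 1 (Matrix.of fun i j : Fin 1 => if i.val + j.val + 1 = 1 then (1 : L) else 0)).Local v)]
    [BorelSpace ((cmDatum L 2 (Matrix.of fun i j : Fin 2 => if i.val + j.val + 1 = 2 then (1 : L) else 0)).Local v ×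
      (cmDatum L 1 (Matrix.of fun i j : Fin 1 => if i.val + j.val + 1 = 1 then (1 : L) else 0)).Local v)]
    [∀ a : ((cmDatum L 2 (Matrix.of fun i j : Fin 2 => if i.val + j.val + 1 = 2 then (1 : L) else 0)).Local v ×
      (cmDatum L 1 (Matrix.of fun i j : Fin 1 => if i.val + j.val + 1 = 1 then (1 : L) else 0)).Local v),
      MeasurableSpace (((cmDatum L 2 (Matrix.of fun i j : Fin 2 => if i.val + j.val + 1 = 2 then (1 : L) else 0)).Local v ×
      (cmDatum L 1 (Matrix.of fun i j : Fin 1 => if i.val + j.val + 1 = 1 then (1 : L) else 0)).Local v) ⧸ Subgroup.centralizer ({a} : Set ((cmDatum L 2 (Matrix.of fun i j : Fin 2 => if i.val + j.val + 1 = 2 then (1 : L) else 0)).Local v ×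
      (cmDatum L 1 (Matrix.of fun i j : Fin 1 => if i.val + j.val + 1 = 1 then (1 : L) else 0)).Local v)))]
    [∀ a : ((cmDatum L 2 (Matrix.of fun i j : Fin 2 => if i.val + j.val + 1 = 2 then (1 : L) else 0)).Local v ×
      (cmDatum L 1 (Matrix.of fun i j : Fin 1 => if i.val + j.val + 1 = 1 then (1 : L) else 0)).Local v),
      BorelSpace (((cmDatum L 2 (Matrix.of fun i j : Fin 2 => if i.val + j.val + 1 = 2 then (1 : L) else 0)).Local v ×
      (cmDatum L 1 (Matrix.of fun i j : Fin 1 => if i.val + j.val + 1 = 1 then (1 : L) else 0)).Local v) ⧸ Subgroup.centralizer ({a} : Set ((cmDatum L 2 (Matrix.of fun i j : Fin 2 => if i.val + j.val + 1 = 2 then (1 : L) else 0)).Local v ×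
      (cmDatum L 1 (Matrix.of fun i j : Fin 1 => if i.val + j.val + 1 = 1 then (1 : L) else 0)).Local v)))]
    (νH : Measure ((cmDatum L 2 (Matrix.of fun i j : Fin 2 => if i.val + j.val + 1 = 2 then (1 : L) else 0)).Local v ×
      (cmDatum L 1 (Matrix.of fun i j : Fin 1 => if i.val + j.val + 1 = 1 then (1 : L) else 0)).Local v)) [νH.IsHaarMeasure] [νH.IsMulRightInvariant]
    (νG₃ : Measure ((cmDatum L 3 (Matrix.of fun i j : Fin 3 => if i.val + j.val + 1 = 3 then (1 : L) else 0)).Local v)) [νG₃.IsHaarMeasure] [νG₃.IsMulRightInvariant]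
    {mH : OrbitalMeasureFamily ((cmDatum L 2 (Matrix.of fun i j : Fin 2 => if i.val + j.val + 1 = 2 then (1 : L) else 0)).Local v ×
      (cmDatum L 1 (Matrix.of fun i j : Fin 1 => if i.val + j.val + 1 = 1 then (1 : L) else 0)).Local v)}
    {mG₃ : OrbitalMeasureFamily ((cmDatum L 3 (Matrix.of fun i j : Fin 3 => if i.val + j.val + 1 = 3 then (1 : L) else 0)).Local v)}
    (hmH : mH.IsCanonical (IsLocalGRegular L v) νH)
    (hmG : mG₃.IsCanonical (fun γ => IsRegularElt (γ.val : GL (Fin 3) (UnitaryGroup.LocalRing L v))) νG₃)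
    {N : Submodule 𝒪[w.1.adicCompletion L] (Fin 3 → w.1.adicCompletion L)}
    (hN : IsVertexLattice (galAdicCompletionMap (L := L) (IsCMField.complexConj L) hw) ϖ ((StdForm.antidiagonal 3).over (w.1.adicCompletion L)) 0 N)
    (Kt : Subgroup ((cmDatum L 3 (Matrix.of fun i j : Fin 3 => if i.val + j.val + 1 = 3 then (1 : L) else 0)).Local v))
    (hKt : ∀ u : ((cmDatum L 3 (Matrix.of fun i j : Fin 3 => if i.val + j.val + 1 = 3 then (1 : L) else 0)).Local v), u ∈ Kt ↔
      mapGL ((localNonsplitEquiv (IsCMField.complexConj L) (Matrix.of fun i j : Fin 3 => if i.val + j.val + 1 = 3 then (1 : L) else 0) (IsCMField.complexConj_ne_one L) w hw u :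
        ↥(unitaryGroupOfForm (galAdicCompletionMap (L := L) (IsCMField.complexConj L) hw) (placeForm (Matrix.of fun i j : Fin 3 => if i.val + j.val + 1 = 3 then (1 : L) else 0) w.1))) :
        GL (Fin 3) (w.1.adicCompletion L)) N = N) :
    ∃ V ∈ 𝓝 (1 : ((cmDatum L 2 (Matrix.of fun i j : Fin 2 => if i.val + j.val + 1 = 2 then (1 : L) else 0)).Local v ×
        (cmDatum L 1 (Matrix.of fun i j : Fin 1 => if i.val + j.val + 1 = 1 then (1 : L) else 0)).Local v)),
      ∀ γH ∈ V, IsLocalGRegular L v γH →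
        (∃ (y : ((cmDatum L 2 (Matrix.of fun i j : Fin 2 => if i.val + j.val + 1 = 2 then (1 : L) else 0)).Local v ×
            (cmDatum L 1 (Matrix.of fun i j : Fin 1 => if i.val + j.val + 1 = 1 then (1 : L) else 0)).Local v)) (d' : Fin 2 → (UnitaryGroup.LocalRing L v)ˣ),
            glDiagonal 2 (UnitaryGroup.LocalRing L v) d' = ((y * γH * y⁻¹).1.val : GL (Fin 2) (UnitaryGroup.LocalRing L v))) →
        ∑ᶠ c : ConjClasses ((cmDatum L 3 (Matrix.of fun i j : Fin 3 => if i.val + j.val + 1 = 3 then (1 : L) else 0)).Local v),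
            ((finExplicitCollection L (Matrix.of fun i j : Fin 3 => if i.val + j.val + 1 = 3 then (1 : L) else 0) μ
              (finExplicitDelta_conj_left_all L (Matrix.of fun i j : Fin 3 => if i.val + j.val + 1 = 3 then (1 : L) else 0) μ)
              (finExplicitDelta_conj_right_all L (Matrix.of fun i j : Fin 3 => if i.val + j.val + 1 = 3 then (1 : L) else 0) μ)) v).Δ γH (Quotient.out c) *
            classOrbitalIntegral mG₃ (Set.indicator (Kt : Set ((cmDatum L 3 (Matrix.of fun i j : Fin 3 => if i.val + j.val + 1 = 3 then (1 : L) else 0)).Local v)) (fun _ => (1 : ℂ))) c =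
          ((νG₃.real (Kt : Set ((cmDatum L 3 (Matrix.of fun i j : Fin 3 => if i.val + j.val + 1 = 3 then (1 : L) else 0)).Local v)) : ℂ) /
            (νH.real ((((cmLocalIntegralLevel L 2 (Matrix.of fun i j : Fin 2 => if i.val + j.val + 1 = 2 then (1 : L) else 0) v).prod
              (cmLocalIntegralLevel L 1 (Matrix.of fun i j : Fin 1 => if i.val + j.val + 1 = 1 then (1 : L) else 0) v) : Subgroup _) : Set _)) : ℂ)) *
          stableOrbitalIntegralRel (IsLocalStablyConjH L v) mH (hFamily L w hw ϖ 0) γH := by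
  classical
  -- `K_H` is compact with non-empty interior; `K₀` is compact open; `K_t = g₀ K₀ g₀⁻¹`
  obtain ⟨hKHc, hKHi⟩ := isCompact_and_interior_nonempty_prod_cmLocalIntegralLevel L v
  obtain ⟨hK₀c, hK₀o⟩ := isCompact_isOpen_cmLocalIntegralLevel L 3 (Matrix.of fun i j : Fin 3 => if i.val + j.val + 1 = 3 then (1 : L) else 0) v
  obtain ⟨g₀, hg₀⟩ := exists_forall_mem_iff_conj_mem_cmLocalIntegralLevel L w hw he hϖ hN Kt hKt
  -- the two germs at `1 ∈ H_v`: the Δ‴-Levi value (★ p855542 §3) and integrality of Levi representatives (§2)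
  obtain ⟨V₁, hV₁, hΔ⟩ := exists_nhds_one_forall_finExplicitDelta_conj_eq_unitModulusChar_of_levi_antidiagOne L w hw μ hμω
  obtain ⟨V₂, hV₂, hKH⟩ := exists_nhds_one_forall_levi_mem_prod_cmLocalIntegralLevel L v w hw hϖ
  refine ⟨V₁ ∩ V₂, inter_mem hV₁ hV₂, fun γH hγ hreg hlevi => ?_⟩
  obtain ⟨y, d', hyd'⟩ := hlevi
  -- the Levi representative `γ_H₁ := y γ_H y⁻¹ ∈ K_H`: stably conjugate, `G`-regular, with the three Levi units
  have hconj : IsConj γH (y * γH * y⁻¹) := isConj_iff.2 ⟨y, rfl⟩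
  have hst : IsLocalStablyConjH L v γH (y * γH * y⁻¹) := (isLocalStablyConjH_of_isConj_and_conj L γH).1 _ hconj
  have hreg₁ : IsLocalGRegular L v (y * γH * y⁻¹) := (isLocalGRegular_conj_iff L y γH).2 hreg
  obtain ⟨ha, hb, h12⟩ := isUnit_levi_of_isLocalGRegular_of_nonsplit L w hw hyd' hreg₁
  have hK := hKH γH hγ.2 y d' hyd'
  have hK₁ : ∀ x : (cmDatum L 1 (Matrix.of fun i j : Fin 1 => if i.val + j.val + 1 = 1 then (1 : L) else 0)).Local v, x ∈ cmLocalIntegralLevel L 1 (Matrix.of fun i j : Fin 1 => if i.val + j.val + 1 = 1 then (1 : L) else 0) v := fun x => by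
    rw [cmLocalIntegralLevel_one_eq_top_of_smul_eq L _ w hw (isUnit_placeForm_antidiagOne (E := L) 1 w.1)]; exact Subgroup.mem_top x
  -- normalise both Haar measures on `K_H` ∕ `K₀` (the measures enter through `νH(K_H)`, `νG₃(K₀)` only)
  obtain ⟨νH₁, _, _, mH₁, hmH₁, hνH₁, -, hstH⟩ := hmH.exists_normalised hKHc hKHi
  obtain ⟨νG₁, _, _, mG₁, hmG₁, hνG₁, hclsG, -⟩ := hmG.exists_normalised hK₀c (by rw [hK₀o.interior_eq]; exact ⟨1, one_mem _⟩)
  -- the `H`-side value at `⟦y γ_H y⁻¹⟧` for the normalised family (★ C′₂)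
  have hΦH₁ := classOrbitalIntegral_indicator_prod_eq_inv_sqrt_of_torus_regular_of_nonsplit L w hw νH₁ hmH₁ hνH₁ hK
    (isLocalGRegular_out_mk hreg₁) (isRegularElt_fst_snd_of_isLocalGRegular L v _ hreg₁).1 hyd' hb hK₁
  -- the clause at `y γ_H y⁻¹` for the normalised families (★ p855385), carried back to `γ_H` (stable class functions)
  have hcl₁ := stableOrbitalIntegralRel_indicator_eq_finsum_delta_of_levi_antidiagOne L w hw νG₁
    (finExplicitCollection L (Matrix.of fun i j : Fin 3 => if i.val + j.val + 1 = 3 then (1 : L) else 0) μ (finExplicitDelta_conj_left_all L (Matrix.of fun i j : Fin 3 => if i.val + j.val + 1 = 3 then (1 : L) else 0) μ) (finExplicitDelta_conj_right_all L (Matrix.of fun i j : Fin 3 => if i.val + j.val + 1 = 3 then (1 : L) else 0) μ) v)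
    mH₁ hmG₁ hνG₁ hyd' hK hreg₁ ha hb h12 hΦH₁ (fun γ₀ _ h₀ => hΔ γH hγ.1 y d' hyd' hK ha hb h12 γ₀ h₀)
  have hcl := (stableOrbitalIntegralRel_eq_finsum_finExplicitDelta_iff_of_isLocalStablyConjH L (Matrix.of fun i j : Fin 3 => if i.val + j.val + 1 = 3 then (1 : L) else 0) μ
    (finExplicitDelta_conj_left_all L (Matrix.of fun i j : Fin 3 => if i.val + j.val + 1 = 3 then (1 : L) else 0) μ) (finExplicitDelta_conj_right_all L (Matrix.of fun i j : Fin 3 => if i.val + j.val + 1 = 3 then (1 : L) else 0) μ) mH₁ mG₁ _ _ hst).2 hcl₁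
  -- `K_t ↦ K₀` inside the finite sum and in the Haar mass
  rw [finsum_delta_mul_classOrbitalIntegral_indicator_eq_of_forall_mem_iff_conj_mem L _ hmG.isAdmissibleOn Kt g₀ hg₀ hreg]
  have hνKt : νG₃.real (Kt : Set ((cmDatum L 3 (Matrix.of fun i j : Fin 3 => if i.val + j.val + 1 = 3 then (1 : L) else 0)).Local v)) = νG₃.real (cmLocalIntegralLevel L 3 (Matrix.of fun i j : Fin 3 => if i.val + j.val + 1 = 3 then (1 : L) else 0) v : Set ((cmDatum L 3 (Matrix.of fun i j : Fin 3 => if i.val + j.val + 1 = 3 then (1 : L) else 0)).Local v)) := by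
    rw [measureReal_def, measureReal_def, measure_eq_of_forall_mem_iff_conj_mem νG₃ g₀ hg₀]
  -- un-normalise: the `G`-side sum and the `H`-side stable integral
  have hG : (∑ᶠ c : ConjClasses ((cmDatum L 3 (Matrix.of fun i j : Fin 3 => if i.val + j.val + 1 = 3 then (1 : L) else 0)).Local v),
      ((finExplicitCollection L (Matrix.of fun i j : Fin 3 => if i.val + j.val + 1 = 3 then (1 : L) else 0) μ (finExplicitDelta_conj_left_all L (Matrix.of fun i j : Fin 3 => if i.val + j.val + 1 = 3 then (1 : L) else 0) μ) (finExplicitDelta_conj_right_all L (Matrix.of fun i j : Fin 3 => if i.val + j.val + 1 = 3 then (1 : L) else 0) μ)) v).Δ γH (Quotient.out c) *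
        classOrbitalIntegral mG₃ ((cmLocalIntegralLevel L 3 (Matrix.of fun i j : Fin 3 => if i.val + j.val + 1 = 3 then (1 : L) else 0) v : Set ((cmDatum L 3 (Matrix.of fun i j : Fin 3 => if i.val + j.val + 1 = 3 then (1 : L) else 0)).Local v)).indicator fun _ => (1 : ℂ)) c) =
      (νG₃.real (cmLocalIntegralLevel L 3 (Matrix.of fun i j : Fin 3 => if i.val + j.val + 1 = 3 then (1 : L) else 0) v : Set ((cmDatum L 3 (Matrix.of fun i j : Fin 3 => if i.val + j.val + 1 = 3 then (1 : L) else 0)).Local v)) : ℂ) * ∑ᶠ c : ConjClasses ((cmDatum L 3 (Matrix.of fun i j : Fin 3 => if i.val + j.val + 1 = 3 then (1 : L) else 0)).Local v),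
        ((finExplicitCollection L (Matrix.of fun i j : Fin 3 => if i.val + j.val + 1 = 3 then (1 : L) else 0) μ (finExplicitDelta_conj_left_all L (Matrix.of fun i j : Fin 3 => if i.val + j.val + 1 = 3 then (1 : L) else 0) μ) (finExplicitDelta_conj_right_all L (Matrix.of fun i j : Fin 3 => if i.val + j.val + 1 = 3 then (1 : L) else 0) μ)) v).Δ γH (Quotient.out c) *
          classOrbitalIntegral mG₁ ((cmLocalIntegralLevel L 3 (Matrix.of fun i j : Fin 3 => if i.val + j.val + 1 = 3 then (1 : L) else 0) v : Set ((cmDatum L 3 (Matrix.of fun i j : Fin 3 => if i.val + j.val + 1 = 3 then (1 : L) else 0)).Local v)).indicator fun _ => (1 : ℂ)) c := by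
    rw [← smul_eq_mul, smul_finsum]
    refine finsum_congr fun c => ?_
    rw [smul_eq_mul, hclsG, mul_left_comm]
  have hF0 : hFamily L w hw ϖ 0 = ((((cmLocalIntegralLevel L 2 (Matrix.of fun i j : Fin 2 => if i.val + j.val + 1 = 2 then (1 : L) else 0) v).prod (cmLocalIntegralLevel L 1 (Matrix.of fun i j : Fin 1 => if i.val + j.val + 1 = 1 then (1 : L) else 0) v)) : Subgroup _) : Set _).indicator fun _ => (1 : ℂ) := rfl
  have hH0 : (νH.real ((((cmLocalIntegralLevel L 2 (Matrix.of fun i j : Fin 2 => if i.val + j.val + 1 = 2 then (1 : L) else 0) v).prod (cmLocalIntegralLevel L 1 (Matrix.of fun i j : Fin 1 => if i.val + j.val + 1 = 1 then (1 : L) else 0) v)) : Subgroup _) : Set _) : ℂ) ≠ 0 := by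
    rw [Ne, Complex.ofReal_eq_zero, measureReal_def, ENNReal.toReal_eq_zero_iff, not_or]
    exact ⟨(Measure.measure_pos_of_nonempty_interior νH hKHi).ne', hKHc.measure_lt_top.ne⟩
  rw [hG, ← hcl, hF0, hstH, hνKt]
  field_simp

end Head

end Summit.HodgeConjecture.HodgeConjecture.Cruxes.H413.F0P3cDyRamAnchorLeviClause

end
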